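/-
Copyright: the b2b-balaban T⁴-continuum CRUX team, row NE7b OWNER lineage `t4-ne7b-p1` (gen 125). Project licence.
-/
import Summits.QuantumFields.BalabanUV.T4Continuum.Spine.NE7b.SupZdPerturbedCoarseForm

/-!
# THE `H + K` COLUMN'S FLUCTUATION COVARIANCE ON EVERY BOUNDED SOURCE, ON `ℤ^d`: for a kernel `|K(p,q)| ≤ εe^{−γ|p−q|₁}`, ANY response
# kernels `h^K_{b″}` with (220)'s three displayed properties (block-scale decay `|h^K_{b″}(p)| ≤ C_he^{−ν|blk n p − b″|₁}`, block means
# `Q′h^K_{b″} = δ_{·b″}`, equation `(H_V + K)h^K_{b″} = N(blk n ·, b″)` with a decaying coarse kernel `N`), and every BOUNDED `u` solving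
# `(H_V + K)u = f`: the response part `h = Σ′_{b″}m(b″)h^K_{b″}` (`m` = block means of `u`, bounded) converges absolutely together with the
# coarse series `Σ′_{b″}m(b″)N(b,b″)`, (i) `|h| ≤ B_uC_hK_ν`, `|u − h| ≤ B_u(1 + C_hK_ν)`; (ii) `Q′(u − h) = 0`; (iii) `(H_V + K)(u − h) = f −
# (Σ′_{b″}m(b″)N(·,b″))∘blk` — (221)'s displays of `C_Kf = u − h` for ALL bounded sources (the decay of the response kernels carries the series,
# no decay of the source needed); (211)'s `H + K` twin, for ANY objects (row NE7b, node U5c; (189)∕(234) BY NAME; [folklore])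

Cell `pub-balaban`, sub-cell `t4`, spine estimate NE7b (`T4WeightBudget.RelWeightBound`; the cell's OWN estimate — NOT PRINTED in
[Bałaban 1983–89], NOT PROVED).  Crux-route work under `Spine/NE7b/` by the row OWNER (`t4-ne7b-p1` gen 125, file (253)) under FREEZE
(0)'s crux-prover clause; NOTHING of Bałaban's is named as a Lean object, valued or asserted; no `T4Continuum/Support` leaf typed; no `def`,
no notation (block means and response parts WRITTEN OUT; the response kernels `h^K`, the coarse kernel `N` and the solution `u` are ANY data
with the displayed properties — (220)∕(222)∕(246) and (213)∕(215) supply them by name); zero `sorry`.  Imports (BY NAME): the OWNER's (234)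
`…SupZdPerturbedCoarseForm` (through it (189) `…SupZdExponentialSums`: `summable_exp_l1`, `tsum_exp_l1_le`; (27) `mem_B`, `sum_B_const`),
Mathlib's `summable_prod_of_nonneg`, `Summable.prod_symm`, `Summable.prod`, `Summable.tsum_comm`, `Summable.tsum_finsetSum`, `tsum_eq_single`.

WHY (located).  (221) typed the perturbed fluctuation covariance `C_Kf = u − Σ″m(b″)h^K_{b″}` for sources of block PROFILE (the road's block
columns), (248) its torus limit, (249) its `V`-dependence, (250) `C_KQ′* = 0`; the successor's item «(211)∕(212) twins for `H + K`» begins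
with the action on ALL bounded sources — the operator `C_K ∈ L(ℓ^∞(ℤ^d))` is then (212)'s packaging.  As in (211) the point is that the
response kernels decay at the block scale in `|blk n p − b″|₁`, so `Σ″m(b″)h^K_{b″}(p)` converges for merely BOUNDED block means; the one new
step against (221) is the kernel row `Σ′_qK(p,q)·` through the response series with a bounded (not decaying) `m`: Fubini on `ℤ^d × ℤ^d` under
the domination `εe^{−γ|p−q|₁}·B_uC_he^{−ν|blk n q − b″|₁}`, summable FIBREWISE (`q` first: the `b″`-sum is `≤ K_ν` uniformly, then the `q`-sum) —
§1; the rest is (221)'s bookkeeping verbatim with the profile replaced by the bound.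

WHAT IS PROVED ([folklore]): §1 **`kernel_row_through_series_bounded`** (Fubini: `Σ′_qK(p,q)Σ″m(b″)h_{b″}(q) = Σ″m(b″)Σ′_qK(p,q)h_{b″}(q)` for
bounded `m` and block-scale decaying `h`); §2 THE END **`zd_perturbed_fluctuation_bounded`** (for ALL `n, a, V, K`, ANY `N, h^K` with the three
displays, every bounded `u` with `(H_V + K)u = f`: absolute convergence of both series, (i), (ii), (iii)); §3 toy.

HONEST (what this is NOT).  Pointwise statements for ANY objects; no operator packaging ((212)'s twin), no symmetry ∕ positivity of `C_K`
(needs (231)∕(233)), no torus; the potential and `a` enter only through the displayed equations (no sign or size condition is used here —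
they are used upstream where the objects are built); scalar skeleton ((A3), NC-NE7b-α UNRULED); nothing of the covariant propagators of
[B4]–[B6]; nothing of Bałaban's asserted.  BY-NAME EFFECT ON THE WALL: NONE.  NE7b NOT PRINTED ∕ NOT PROVED; spine PROVED 0∕9; rung (B)+1
— the programme's measures remain FINITE-torus statements; NOT the mass gap, NOT Clay.  HONEST DEPENDENCY: continuum YM on T⁴ ⇐ BetaPertH
∧ nine spine estimates (0∕9 proved); BetaPertH ⇐ (D1) ∧ (D4) ∧ CAP+tail; G-an2-4 gates asym, D1 and NE2∕3∕4.
-/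

set_option autoImplicit false

noncomputable section

namespace Summit.QuantumFields.BalabanUV.T4Continuum.NE7b.SupZdPerturbedCovarianceBounded

open Real Filter Topology
open Literature.MathematicalPhysics.QuantumFieldTheory.Balaban1983to89
open B6QGQLower276 (X e blk B mem_B sum_B_const)
open SupZdExponentialSums (summable_exp_l1 tsum_exp_l1_le)
open SupZdPerturbedColumn (K_pos)

variable {d : ℕ}

/-! ## §1. A kernel row through a response series with bounded coefficients (Fubini, fibrewise) -/

/-- **KERNEL ROW THROUGH THE RESPONSE SERIES, BOUNDED COEFFICIENTS**: `|K(p,q)| ≤ εe^{−γ|p−q|₁}` (`γ > 0`), `|m(b″)| ≤ M_m`,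
`|h_{b″}(q)| ≤ C_he^{−ν|blk n q − b″|₁}` (`ν > 0`) ⟹ `Σ′_qK(p,q)Σ″m(b″)h_{b″}(q) = Σ″m(b″)Σ′_qK(p,q)h_{b″}(q)`, the outer series on the right
converging absolutely — Fibrewise summability on `ℤ^d × ℤ^d` (`q` first: `Σ″e^{−ν|blk n q − b″|₁} ≤ K_ν` uniformly in `q`, (189)), then
`Summable.prod_symm` ∕ `Summable.tsum_comm`. [folklore] -/
theorem kernel_row_through_series_bounded (n : ℕ) {ε γ ν Mm Ch : ℝ} (hε : 0 ≤ ε) (hγ : 0 < γ) (hν : 0 < ν) (hMm : 0 ≤ Mm)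
    (hCh : 0 ≤ Ch) (K : X d → X d → ℝ) (hK : ∀ p q, |K p q| ≤ ε * exp (-(γ * ∑ i, (((p i - q i).natAbs : ℕ) : ℝ))))
    (mu : X d → ℝ) (hr : X d → X d → ℝ) (hmu : ∀ b'', |mu b''| ≤ Mm)
    (hrd : ∀ b'' q, |hr b'' q| ≤ Ch * exp (-(ν * ∑ i, (((blk n q i - b'' i).natAbs : ℕ) : ℝ)))) (p : X d) :
    Summable (fun b'' : X d => mu b'' * ∑' q : X d, K p q * hr b'' q) ∧
    ∑' q : X d, K p q * ∑' b'' : X d, mu b'' * hr b'' q = ∑' b'' : X d, mu b'' * ∑' q : X d, K p q * hr b'' q := by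
  classical
  -- the summand on `ℤ^d × ℤ^d`, pairs `(q, b″)`, and its domination
  obtain ⟨F, hF⟩ : ∃ F : X d → X d → ℝ, ∀ q b'', F q b'' = K p q * (mu b'' * hr b'' q) := ⟨_, fun _ _ => rfl⟩
  obtain ⟨G, hG⟩ : ∃ G : X d × X d → ℝ, ∀ x, G x = (ε * exp (-(γ * ∑ i, (((p i - x.1 i).natAbs : ℕ) : ℝ))))
      * (Mm * Ch * exp (-(ν * ∑ i, (((blk n x.1 i - x.2 i).natAbs : ℕ) : ℝ)))) := ⟨_, fun _ => rfl⟩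
  have hG0 : 0 ≤ G := fun x => by simp only [Pi.zero_apply, hG]; positivity
  have hKν : 0 < (2 * (1 - exp (-ν))⁻¹) ^ d := K_pos (d := d) hν
  have hGs : Summable G := by
    refine (summable_prod_of_nonneg hG0).2 ⟨fun q => ?_, ?_⟩
    · simp only [hG]
      exact ((summable_exp_l1 hν (blk n q)).mul_left (Mm * Ch)).mul_left _
    · simp only [hG]
      have hb : ∀ q : X d, ∑' b'' : X d, (ε * exp (-(γ * ∑ i, (((p i - q i).natAbs : ℕ) : ℝ))))
          * (Mm * Ch * exp (-(ν * ∑ i, (((blk n q i - b'' i).natAbs : ℕ) : ℝ))))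
          ≤ (ε * exp (-(γ * ∑ i, (((p i - q i).natAbs : ℕ) : ℝ)))) * (Mm * Ch * (2 * (1 - exp (-ν))⁻¹) ^ d) := by
        intro q
        rw [tsum_mul_left, tsum_mul_left]
        exact mul_le_mul_of_nonneg_left (mul_le_mul_of_nonneg_left (tsum_exp_l1_le hν (blk n q)) (by positivity)) (by positivity)
      refine Summable.of_nonneg_of_le (fun q => tsum_nonneg fun b'' => by positivity) hb ?_
      exact ((summable_exp_l1 hγ p).mul_left ε).mul_right _
  have hFsum' : Summable (Function.uncurry F) := Summable.of_norm_bounded hGs fun x => by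
    simp only [Function.uncurry, hF, hG, Real.norm_eq_abs]
    rw [abs_mul, abs_mul, mul_assoc Mm]
    exact mul_le_mul (hK p x.1) (mul_le_mul (hmu x.2) (hrd x.2 x.1) (abs_nonneg _) hMm) (by positivity) (by positivity)
  have hFsum : Summable (Function.uncurry fun b'' q => F q b'') := hFsum'.prod_symm.congr fun _ => rfl
  have hrow : ∀ b'', ∑' q : X d, F q b'' = mu b'' * ∑' q : X d, K p q * hr b'' q := fun b'' => by
    rw [← tsum_mul_left]; exact tsum_congr fun q => by rw [hF]; ring
  refine ⟨?_, ?_⟩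
  · have h := hFsum.prod
    simp only [Function.uncurry] at h
    exact h.congr fun b'' => hrow b''
  · have e1 : ∀ q, K p q * ∑' b'' : X d, mu b'' * hr b'' q = ∑' b'' : X d, F q b'' := fun q => by
      rw [← tsum_mul_left]; exact tsum_congr fun b'' => by rw [hF]
    rw [tsum_congr e1, ← hFsum'.tsum_comm]
    exact tsum_congr hrow

/-! ## §2. THE END: the fluctuation part of a bounded solution of the perturbed equation -/

/-- **HEADLINE — THE PERTURBED FLUCTUATION COVARIANCE ON EVERY BOUNDED SOURCE**: for every mesh `n`, coupling `a`, potential `V`, kernel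
`|K(p,q)| ≤ εe^{−γ|p−q|₁}` (`ε ≥ 0`, `γ > 0`), ANY coarse kernel `|N(b,c)| ≤ C_Ne^{−ν_N|b−c|₁}` and ANY response kernels `h^K_{b″}` with
`|h^K_{b″}(p)| ≤ C_he^{−ν|blk n p − b″|₁}` (`ν > 0`), `(n+1)^{−d}Σ_{q ∈ B n b}h^K_{b″}(q) = δ_{bb″}` and `(H_V + K)h^K_{b″} = N(blk n ·, b″)` ((220)'s three
displays), and every BOUNDED `u` (`|u| ≤ B_u`) with `(H_V + K)u = f`: with `m(b″) = (n+1)^{−d}Σ_{B n b″}u` and `h = Σ″m(b″)h^K_{b″}`, both `Σ″m(b″)h^K_{b″}(p)`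
and `Σ″m(b″)N(b,b″)` converge absolutely, (i) `|h(p)| ≤ B_uC_hK_ν` and `|u(p) − h(p)| ≤ B_u(1 + C_hK_ν)`; (ii) the block means of `u − h` vanish;
(iii) `(H_V + K)(u − h)(p) = f(p) − Σ″m(b″)N(blk n p, b″)` — (221) for ALL bounded sources (§1 for the kernel row). [folklore] -/
theorem zd_perturbed_fluctuation_bounded (n : ℕ) (a : ℝ) {ε γ ν νN Ch CN Bu : ℝ} (hε : 0 ≤ ε) (hγ : 0 < γ) (hν : 0 < ν)
    (hνN : 0 < νN) (V : X d → ℝ)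
    (K : X d → X d → ℝ) (hK : ∀ p q, |K p q| ≤ ε * exp (-(γ * ∑ i, (((p i - q i).natAbs : ℕ) : ℝ))))
    (N : X d → X d → ℝ) (hN : ∀ b c, |N b c| ≤ CN * exp (-(νN * ∑ i, (((b i - c i).natAbs : ℕ) : ℝ))))
    (hr : X d → X d → ℝ) (hrd : ∀ b'' p, |hr b'' p| ≤ Ch * exp (-(ν * ∑ i, (((blk n p i - b'' i).natAbs : ℕ) : ℝ))))
    (hrQ : ∀ b'' b, (((n : ℝ) + 1) ^ d)⁻¹ * ∑ q ∈ B n b, hr b'' q = if b = b'' then 1 else 0)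
    (hrH : ∀ b'' p, ((n : ℝ) + 1) ^ 2 * ∑ μ', (2 * hr b'' p - hr b'' (p + e μ') - hr b'' (p - e μ'))
      + a / ((n : ℝ) + 1) ^ d * ∑ q ∈ B n (blk n p), hr b'' q + V p * hr b'' p + ∑' q : X d, K p q * hr b'' q
      = N (blk n p) b'')
    (f u : X d → ℝ) (huB : ∀ p, |u p| ≤ Bu)
    (hu : ∀ p, ((n : ℝ) + 1) ^ 2 * ∑ μ', (2 * u p - u (p + e μ') - u (p - e μ'))
      + a / ((n : ℝ) + 1) ^ d * ∑ q ∈ B n (blk n p), u q + V p * u p + ∑' q : X d, K p q * u q = f p) :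
    (∀ p, Summable fun b'' : X d => ((((n : ℝ) + 1) ^ d)⁻¹ * ∑ q ∈ B n b'', u q) * hr b'' p) ∧
    (∀ b, Summable fun b'' : X d => ((((n : ℝ) + 1) ^ d)⁻¹ * ∑ q ∈ B n b'', u q) * N b b'') ∧
    (∀ p, |∑' b'' : X d, ((((n : ℝ) + 1) ^ d)⁻¹ * ∑ q ∈ B n b'', u q) * hr b'' p| ≤ Bu * Ch * (2 * (1 - exp (-ν))⁻¹) ^ d) ∧
    (∀ p, |u p - ∑' b'' : X d, ((((n : ℝ) + 1) ^ d)⁻¹ * ∑ q ∈ B n b'', u q) * hr b'' p|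
      ≤ Bu * (1 + Ch * (2 * (1 - exp (-ν))⁻¹) ^ d)) ∧
    (∀ b, (((n : ℝ) + 1) ^ d)⁻¹ * ∑ q ∈ B n b,
      (u q - ∑' b'' : X d, ((((n : ℝ) + 1) ^ d)⁻¹ * ∑ q' ∈ B n b'', u q') * hr b'' q) = 0) ∧
    (∀ p, ((n : ℝ) + 1) ^ 2 * ∑ μ',
        (2 * (u p - ∑' b'' : X d, ((((n : ℝ) + 1) ^ d)⁻¹ * ∑ q ∈ B n b'', u q) * hr b'' p)
        - (u (p + e μ') - ∑' b'' : X d, ((((n : ℝ) + 1) ^ d)⁻¹ * ∑ q ∈ B n b'', u q) * hr b'' (p + e μ'))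
        - (u (p - e μ') - ∑' b'' : X d, ((((n : ℝ) + 1) ^ d)⁻¹ * ∑ q ∈ B n b'', u q) * hr b'' (p - e μ')))
      + a / ((n : ℝ) + 1) ^ d * ∑ q ∈ B n (blk n p),
        (u q - ∑' b'' : X d, ((((n : ℝ) + 1) ^ d)⁻¹ * ∑ q' ∈ B n b'', u q') * hr b'' q)
      + V p * (u p - ∑' b'' : X d, ((((n : ℝ) + 1) ^ d)⁻¹ * ∑ q ∈ B n b'', u q) * hr b'' p)
      + ∑' q : X d, K p q * (u q - ∑' b'' : X d, ((((n : ℝ) + 1) ^ d)⁻¹ * ∑ q' ∈ B n b'', u q') * hr b'' q)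
      = f p - ∑' b'' : X d, ((((n : ℝ) + 1) ^ d)⁻¹ * ∑ q ∈ B n b'', u q) * N (blk n p) b'') := by
  classical
  have hvol : (0 : ℝ) < ((n : ℝ) + 1) ^ d := by positivity
  have hKν : 0 < (2 * (1 - exp (-ν))⁻¹) ^ d := K_pos (d := d) hν
  have hBu : 0 ≤ Bu := (abs_nonneg _).trans (huB 0)
  have hCh : 0 ≤ Ch := by
    have h := (abs_nonneg _).trans (hrd 0 0)
    exact le_of_mul_le_mul_right (by rw [zero_mul]; exact h) (exp_pos _)
  -- abbreviation: the block means of `u`; bounded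
  obtain ⟨mu, hmu⟩ : ∃ mu : X d → ℝ, ∀ b'', mu b'' = (((n : ℝ) + 1) ^ d)⁻¹ * ∑ q ∈ B n b'', u q := ⟨_, fun _ => rfl⟩
  have hmud : ∀ b'', |mu b''| ≤ Bu := by
    intro b''
    rw [hmu, abs_mul, abs_inv, abs_of_pos hvol, inv_mul_le_iff₀ hvol]
    calc |∑ q ∈ B n b'', u q| ≤ ∑ q ∈ B n b'', |u q| := Finset.abs_sum_le_sum_abs _ _
      _ ≤ ∑ _q ∈ B n b'', Bu := Finset.sum_le_sum fun q _ => huB q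
      _ = _ := sum_B_const _ _
  have hrb : ∀ b'' p, |hr b'' p| ≤ Ch := fun b'' p =>
    (hrd b'' p).trans (mul_le_of_le_one_right hCh (exp_le_one_iff.2 (neg_nonpos.2 (by positivity))))
  -- the response part: domination, absolute convergence, bound
  have hdom : ∀ p b'', |mu b'' * hr b'' p| ≤ Bu * Ch * exp (-(ν * ∑ i, (((blk n p i - b'' i).natAbs : ℕ) : ℝ))) := fun p b'' => by
    rw [abs_mul]
    calc |mu b''| * |hr b'' p| ≤ Bu * (Ch * exp (-(ν * ∑ i, (((blk n p i - b'' i).natAbs : ℕ) : ℝ)))) :=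
          mul_le_mul (hmud b'') (hrd b'' p) (abs_nonneg _) hBu
      _ = _ := by ring
  have hs : ∀ p, Summable fun b'' : X d => mu b'' * hr b'' p := fun p =>
    Summable.of_norm_bounded ((summable_exp_l1 hν (blk n p)).mul_left (Bu * Ch)) fun b'' => by
      rw [Real.norm_eq_abs]; exact hdom p b''
  have hsN : ∀ b, Summable fun b'' : X d => mu b'' * N b b'' := fun b =>
    Summable.of_norm_bounded ((summable_exp_l1 hνN b).mul_left (Bu * CN)) fun b'' => by
      rw [Real.norm_eq_abs, abs_mul]
      calc |mu b''| * |N b b''| ≤ Bu * (CN * exp (-(νN * ∑ i, (((b i - b'' i).natAbs : ℕ) : ℝ)))) :=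
            mul_le_mul (hmud b'') (hN b b'') (abs_nonneg _) hBu
        _ = _ := by ring
  have hhd : ∀ p, |∑' b'' : X d, mu b'' * hr b'' p| ≤ Bu * Ch * (2 * (1 - exp (-ν))⁻¹) ^ d := by
    intro p
    have h1 : |∑' b'' : X d, mu b'' * hr b'' p| ≤ ∑' b'' : X d, |mu b'' * hr b'' p| := by
      have := norm_tsum_le_tsum_norm (hs p).norm
      simpa only [Real.norm_eq_abs] using this
    have h2 := (hs p).abs.tsum_le_tsum (hdom p) ((summable_exp_l1 hν (blk n p)).mul_left (Bu * Ch))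
    rw [tsum_mul_left] at h2
    exact h1.trans (h2.trans (mul_le_mul_of_nonneg_left (tsum_exp_l1_le hν (blk n p)) (by positivity)))
  -- fold the displays
  have efold : ∀ p b'', ((((n : ℝ) + 1) ^ d)⁻¹ * ∑ q ∈ B n b'', u q) * hr b'' p = mu b'' * hr b'' p := fun p b'' => by rw [hmu]
  have efoldN : ∀ b b'', ((((n : ℝ) + 1) ^ d)⁻¹ * ∑ q ∈ B n b'', u q) * N b b'' = mu b'' * N b b'' := fun b b'' => by rw [hmu]
  simp only [efold, efoldN]
  refine ⟨hs, hsN, hhd, fun p => ?_, fun b => ?_, fun p => ?_⟩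
  · -- (i) the fluctuation part is bounded
    calc |u p - ∑' b'' : X d, mu b'' * hr b'' p| ≤ |u p| + |∑' b'' : X d, mu b'' * hr b'' p| := abs_sub _ _
      _ ≤ Bu + Bu * Ch * (2 * (1 - exp (-ν))⁻¹) ^ d := add_le_add (huB p) (hhd p)
      _ = _ := by ring
  · -- (ii) zero block means: the block means of the response part are those of `u`
    have hmean : (((n : ℝ) + 1) ^ d)⁻¹ * ∑ q ∈ B n b, ∑' b'' : X d, mu b'' * hr b'' q = mu b := by
      rw [← Summable.tsum_finsetSum (fun q _ => hs q), ← Summable.tsum_mul_left _ (summable_sum fun q _ => hs q)]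
      have e1 : ∀ b'' : X d, (((n : ℝ) + 1) ^ d)⁻¹ * ∑ q ∈ B n b, mu b'' * hr b'' q = mu b'' * (if b = b'' then 1 else 0) := by
        intro b''
        rw [← hrQ b'' b, Finset.mul_sum, Finset.mul_sum, Finset.mul_sum]
        exact Finset.sum_congr rfl fun q _ => by ring
      simp only [e1]
      rw [tsum_eq_single b (fun b'' hb'' => by rw [if_neg (Ne.symm hb''), mul_zero]), if_pos rfl, mul_one]
    rw [Finset.sum_sub_distrib, mul_sub, hmean, hmu, sub_self]
  · -- (iii) the equation
    obtain ⟨hSK, hKrow⟩ := kernel_row_through_series_bounded (d := d) n hε hγ hν hBu hCh K hK mu hr hmud hrd p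
    -- the stencil of `H_V + K` through `Σ′_{b″}` (the response kernels' equation termwise), and linearity
    have hpt : ∑' b'' : X d, (((n : ℝ) + 1) ^ 2 * ∑ μ', (2 * (mu b'' * hr b'' p) - mu b'' * hr b'' (p + e μ') - mu b'' * hr b'' (p - e μ'))
        + a / ((n : ℝ) + 1) ^ d * ∑ q ∈ B n (blk n p), mu b'' * hr b'' q + V p * (mu b'' * hr b'' p)
        + mu b'' * ∑' q : X d, K p q * hr b'' q)
        = ∑' b'' : X d, mu b'' * N (blk n p) b'' := by
      refine tsum_congr fun b'' => ?_
      rw [← hrH b'' p, ← Finset.mul_sum]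
      have e2 : ∑ μ', (2 * (mu b'' * hr b'' p) - mu b'' * hr b'' (p + e μ') - mu b'' * hr b'' (p - e μ'))
          = mu b'' * ∑ μ', (2 * hr b'' p - hr b'' (p + e μ') - hr b'' (p - e μ')) := by
        rw [Finset.mul_sum]; exact Finset.sum_congr rfl fun μ' _ => by ring
      rw [e2]
      ring
    have hS1 : ∀ μ' : Fin d, Summable fun b'' : X d =>
        2 * (mu b'' * hr b'' p) - mu b'' * hr b'' (p + e μ') - mu b'' * hr b'' (p - e μ') :=
      fun μ' => (((hs p).mul_left 2).sub (hs (p + e μ'))).sub (hs (p - e μ'))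
    have hS1s : Summable fun b'' : X d =>
        ∑ μ', (2 * (mu b'' * hr b'' p) - mu b'' * hr b'' (p + e μ') - mu b'' * hr b'' (p - e μ')) :=
      summable_sum fun μ' _ => hS1 μ'
    have hS2 : Summable fun b'' : X d => ∑ q ∈ B n (blk n p), mu b'' * hr b'' q := summable_sum fun q _ => hs q
    have hT1 : ∑' b'' : X d, ∑ μ', (2 * (mu b'' * hr b'' p) - mu b'' * hr b'' (p + e μ') - mu b'' * hr b'' (p - e μ'))
        = ∑ μ', (2 * (∑' b'' : X d, mu b'' * hr b'' p) - (∑' b'' : X d, mu b'' * hr b'' (p + e μ'))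
          - (∑' b'' : X d, mu b'' * hr b'' (p - e μ'))) := by
      rw [Summable.tsum_finsetSum fun μ' _ => hS1 μ']
      refine Finset.sum_congr rfl fun μ' _ => ?_
      rw [(((hs p).mul_left 2).sub (hs (p + e μ'))).tsum_sub (hs (p - e μ')), ((hs p).mul_left 2).tsum_sub (hs (p + e μ')),
        (hs p).tsum_mul_left 2]
    have hT2 : ∑' b'' : X d, ∑ q ∈ B n (blk n p), mu b'' * hr b'' q = ∑ q ∈ B n (blk n p), ∑' b'' : X d, mu b'' * hr b'' q :=
      Summable.tsum_finsetSum fun q _ => hs q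
    have hmain : ∑' b'' : X d, (((n : ℝ) + 1) ^ 2 * ∑ μ', (2 * (mu b'' * hr b'' p) - mu b'' * hr b'' (p + e μ')
          - mu b'' * hr b'' (p - e μ'))
        + a / ((n : ℝ) + 1) ^ d * ∑ q ∈ B n (blk n p), mu b'' * hr b'' q + V p * (mu b'' * hr b'' p)
        + mu b'' * ∑' q : X d, K p q * hr b'' q)
        = ((n : ℝ) + 1) ^ 2 * ∑' b'' : X d, ∑ μ', (2 * (mu b'' * hr b'' p) - mu b'' * hr b'' (p + e μ')
            - mu b'' * hr b'' (p - e μ'))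
          + a / ((n : ℝ) + 1) ^ d * ∑' b'' : X d, ∑ q ∈ B n (blk n p), mu b'' * hr b'' q
          + V p * ∑' b'' : X d, mu b'' * hr b'' p + ∑' b'' : X d, mu b'' * ∑' q : X d, K p q * hr b'' q := by
      rw [Summable.tsum_add (((hS1s.mul_left _).add (hS2.mul_left _)).add ((hs p).mul_left _)) hSK,
        Summable.tsum_add ((hS1s.mul_left _).add (hS2.mul_left _)) ((hs p).mul_left _),
        Summable.tsum_add (hS1s.mul_left _) (hS2.mul_left _), hS1s.tsum_mul_left (((n : ℝ) + 1) ^ 2),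
        hS2.tsum_mul_left (a / ((n : ℝ) + 1) ^ d), (hs p).tsum_mul_left (V p)]
    -- `(H_V + K)h = Σ′ m(b″)N(blk n p, b″)`
    have hHh : ((n : ℝ) + 1) ^ 2 * ∑ μ', (2 * (∑' b'' : X d, mu b'' * hr b'' p) - (∑' b'' : X d, mu b'' * hr b'' (p + e μ'))
          - (∑' b'' : X d, mu b'' * hr b'' (p - e μ')))
        + a / ((n : ℝ) + 1) ^ d * ∑ q ∈ B n (blk n p), (∑' b'' : X d, mu b'' * hr b'' q) + V p * (∑' b'' : X d, mu b'' * hr b'' p)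
        + ∑' q : X d, K p q * ∑' b'' : X d, mu b'' * hr b'' q
        = ∑' b'' : X d, mu b'' * N (blk n p) b'' := by rw [← hpt, hmain, hT1, hT2, hKrow]
    -- the kernel row is linear on `u − h`: both pieces converge
    have hhb : ∀ q, |∑' b'' : X d, mu b'' * hr b'' q| ≤ Bu * Ch * (2 * (1 - exp (-ν))⁻¹) ^ d := hhd
    have hsKu : Summable fun q : X d => K p q * u q :=
      Summable.of_norm_bounded (((summable_exp_l1 hγ p).mul_left ε).mul_right Bu) fun q => by
        rw [Real.norm_eq_abs, abs_mul]; exact mul_le_mul (hK p q) (huB q) (abs_nonneg _) (by positivity)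
    have hsKh : Summable fun q : X d => K p q * ∑' b'' : X d, mu b'' * hr b'' q :=
      Summable.of_norm_bounded (((summable_exp_l1 hγ p).mul_left ε).mul_right (Bu * Ch * (2 * (1 - exp (-ν))⁻¹) ^ d))
        fun q => by
        rw [Real.norm_eq_abs, abs_mul]; exact mul_le_mul (hK p q) (hhb q) (abs_nonneg _) (by positivity)
    have hKsub : ∑' q : X d, K p q * (u q - ∑' b'' : X d, mu b'' * hr b'' q)
        = ∑' q : X d, K p q * u q - ∑' q : X d, K p q * ∑' b'' : X d, mu b'' * hr b'' q := by
      rw [← hsKu.tsum_sub hsKh]; exact tsum_congr fun q => by ring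
    rw [← hHh, ← hu p, hKsub]
    have e1 : ∑ μ', (2 * (u p - ∑' b'' : X d, mu b'' * hr b'' p) - (u (p + e μ') - ∑' b'' : X d, mu b'' * hr b'' (p + e μ'))
        - (u (p - e μ') - ∑' b'' : X d, mu b'' * hr b'' (p - e μ')))
        = ∑ μ', (2 * u p - u (p + e μ') - u (p - e μ')) - ∑ μ', (2 * (∑' b'' : X d, mu b'' * hr b'' p)
          - (∑' b'' : X d, mu b'' * hr b'' (p + e μ')) - (∑' b'' : X d, mu b'' * hr b'' (p - e μ'))) := by
      rw [← Finset.sum_sub_distrib]; exact Finset.sum_congr rfl fun μ' _ => by ring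
    have e2 : ∑ q ∈ B n (blk n p), (u q - ∑' b'' : X d, mu b'' * hr b'' q)
        = ∑ q ∈ B n (blk n p), u q - ∑ q ∈ B n (blk n p), ∑' b'' : X d, mu b'' * hr b'' q :=
      Finset.sum_sub_distrib (f := fun q => u q) (g := fun q => ∑' b'' : X d, mu b'' * hr b'' q)
    rw [e1, e2]
    ring

/-! ## §3. Toy -/

/-- Toy (`d = 1`, `n = 0`): §1's exchange with everything zero — both sides are `0`. -/
example (p : X 1) :
    ∑' q : X 1, (fun _ _ => (0 : ℝ)) p q * ∑' b'' : X 1, (fun _ => (0 : ℝ)) b'' * (fun _ _ => (0 : ℝ)) b'' q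
      = ∑' b'' : X 1, (fun _ => (0 : ℝ)) b'' * ∑' q : X 1, (fun _ _ => (0 : ℝ)) p q * (fun _ _ => (0 : ℝ)) b'' q :=
  (kernel_row_through_series_bounded (d := 1) 0 (ε := 0) (γ := 1) (ν := 1) (Mm := 0) (Ch := 0) le_rfl one_pos one_pos le_rfl le_rfl
    (fun _ _ => 0) (fun _ _ => by simp) (fun _ => 0) (fun _ _ => 0) (fun _ => by simp) (fun _ _ => by simp) p).2

end Summit.QuantumFields.BalabanUV.T4Continuum.NE7b.SupZdPerturbedCovarianceBounded
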